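import Mathlib
import Literature.RepresentationTheory.FiniteGroups.IrreducibleCharacters
import Summits.MatrixMultiplication.MatrixMultiplication.Theorems.LevelGradedCohnUmansGradedDesignFamilyStubWreathBudgetIndex

/-!
# Stub `stub_tilingUniversality` for the line `tiling-families` of `LevelGradedCohnUmans.GradedDesignFamily`

Regime II of the family criterion ("asymptotically perfect graded tilings by many small blocks").
A *tiling family* provides a fixed block-to-dimension ratio `λ > 1` and, for every efficiency
`η < 1`, a finite host `G`, a bi-invariant test space `J ≤ ℂ^G` with wall
`D = Σ_{χ ∈ Irr G ∩ J} χ(1)² > 0`, and `t` simultaneously `J`-separated blocks `(X_i, Y_i, Z_i)`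
with `(λ χ(1))³ ≤ V_i := |X_i| |Y_i| |Z_i|` for every block and every visible irreducible `χ`, and
`η D ≤ Σ_i V_i^{2/3}`.  Then for every `ε > 0` some member of the family is a graded simultaneous
design at exponent `2 + ε`: `Σ_{χ ∈ Irr G ∩ J} χ(1)^{2+ε} < Σ_i V_i^{(2+ε)/3}`.

The proof is power-mean bookkeeping.  Given `ε`, pick `η ∈ (λ^{-ε}, 1)` and the corresponding
member; let `m` be the largest visible degree.  Termwise `χ(1)^{2+ε} ≤ χ(1)² m^ε`, so the graded
budget is `≤ m^ε D`; termwise `V_i^{(2+ε)/3} = V_i^{2/3} V_i^{ε/3} ≥ V_i^{2/3} (λ m)^ε`, so the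
value is `≥ (λ m)^ε η D`; and `η λ^ε > 1`, `m^ε D > 0` make the comparison strict.  The
real-analytic core is isolated in `tilingUniversality_abstract`; the assembly only uses the
finiteness of `Irr G` (`irrChars_finite_holds`) and `χ(1) ≥ 1` (`wreathBudget_one_le_re`).
[cite: CohnKleinbergSzegedyUmans2005, Thm. 5.5]
-/

noncomputable section

set_option linter.dupNamespace false

open scoped BigOperators
open Literature.RepresentationTheory.FiniteGroups

namespace Summit.MatrixMultiplication.MatrixMultiplication.Theorems.GradedDesignFamily

/-- Choice of the efficiency: for `λ > 1`, `ε > 0` there is `η ∈ (0, 1)` with `η λ^ε > 1`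
(any `η` strictly between `λ^{-ε} < 1` and `1`). [folklore] -/
theorem tilingUniversality_eta {lam ε : ℝ} (hlam : 1 < lam) (hε : 0 < ε) :
    ∃ η : ℝ, η < 1 ∧ 0 < η ∧ 1 < η * lam ^ ε := by
  have hpow : 1 < lam ^ ε := Real.one_lt_rpow hlam hε
  have hpos : 0 < lam ^ ε := one_pos.trans hpow
  obtain ⟨η, h1, h2⟩ := exists_between (inv_lt_one_of_one_lt₀ hpow)
  refine ⟨η, h2, (inv_pos.mpr hpos).trans h1, ?_⟩
  calc (1 : ℝ) = (lam ^ ε)⁻¹ * lam ^ ε := (inv_mul_cancel₀ hpos.ne').symm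
    _ < η * lam ^ ε := mul_lt_mul_of_pos_right h1 hpos

/-- Termwise budget bound: if `1 ≤ d ≤ m` and `0 ≤ e` then `d^{2+e} ≤ d² m^e`. [folklore] -/
theorem tilingUniversality_term_budget {d m e : ℝ} (hd : 1 ≤ d) (hdm : d ≤ m) (he : 0 ≤ e) :
    d ^ (2 + e) ≤ d ^ (2 : ℝ) * m ^ e := by
  have hd0 : 0 < d := one_pos.trans_le hd
  rw [Real.rpow_add hd0]
  exact mul_le_mul_of_nonneg_left (Real.rpow_le_rpow hd0.le hdm he) (Real.rpow_nonneg hd0.le _)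

/-- Termwise value bound: if `0 < c`, `c³ ≤ V` and `0 ≤ e` then `V^{2/3} c^e ≤ V^{(2+e)/3}`
(split `V^{(2+e)/3} = V^{2/3} V^{e/3}` and use `c^e = (c³)^{e/3} ≤ V^{e/3}`). [folklore] -/
theorem tilingUniversality_term_value {c V e : ℝ} (hc : 0 < c) (hV : c ^ (3 : ℕ) ≤ V)
    (he : 0 ≤ e) : V ^ ((2 : ℝ) / 3) * c ^ e ≤ V ^ ((2 + e) / 3) := by
  have hc3 : 0 < c ^ (3 : ℕ) := pow_pos hc 3
  have hV0 : 0 < V := hc3.trans_le hV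
  have hsplit : V ^ ((2 + e) / 3) = V ^ ((2 : ℝ) / 3) * V ^ (e / 3) := by
    rw [← Real.rpow_add hV0]
    congr 1
    ring
  rw [hsplit]
  refine mul_le_mul_of_nonneg_left ?_ (Real.rpow_nonneg hV0.le _)
  calc c ^ e = (c ^ (3 : ℕ)) ^ (e / 3) := by
        rw [← Real.rpow_natCast, ← Real.rpow_mul hc.le]
        congr 1
        push_cast
        ring
    _ ≤ V ^ (e / 3) := Real.rpow_le_rpow hc3.le hV (by linarith)

/-- **The real-analytic core of `stub_tilingUniversality`.**  A finite index set `S` with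
"degrees" `d χ ≥ 1` and wall `D = Σ_{χ ∈ S} (d χ)² > 0`, "volumes" `V i` (`i < t`) with
`(λ d χ)³ ≤ V i` for all `i` and all `χ ∈ S`, efficiency `η D ≤ Σ_i (V i)^{2/3}`, and
`η λ^ε > 1` (`ε, η, λ > 0`) force `Σ_{χ ∈ S} (d χ)^{2+ε} < Σ_i (V i)^{(2+ε)/3}`: with `m` the
largest degree, the left side is `≤ m^ε D < η λ^ε m^ε D ≤` the right side.
[cite: CohnKleinbergSzegedyUmans2005, Thm. 5.5] -/
theorem tilingUniversality_abstract {α : Type*} (S : Finset α) (d : α → ℝ) (t : ℕ)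
    (V : Fin t → ℝ) (lam η ε : ℝ) (hε : 0 < ε) (hlam : 0 < lam) (hkey : 1 < η * lam ^ ε)
    (hd : ∀ χ ∈ S, 1 ≤ d χ) (hD0 : 0 < ∑ χ ∈ S, d χ ^ (2 : ℝ))
    (hblk : ∀ i : Fin t, ∀ χ ∈ S, (lam * d χ) ^ (3 : ℕ) ≤ V i)
    (heff : η * ∑ χ ∈ S, d χ ^ (2 : ℝ) ≤ ∑ i, V i ^ ((2 : ℝ) / 3)) :
    ∑ χ ∈ S, d χ ^ (2 + ε) < ∑ i, V i ^ ((2 + ε) / 3) := by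
  -- a visible degree of maximal size
  have hne : S.Nonempty := by
    by_contra h
    rw [Finset.not_nonempty_iff_eq_empty] at h
    simp [h] at hD0
  obtain ⟨χm, hχm, hmax⟩ := Finset.exists_max_image S d hne
  set m := d χm with hm
  set D := ∑ χ ∈ S, d χ ^ (2 : ℝ) with hD
  have hm0 : 0 < m := one_pos.trans_le (hd χm hχm)
  have hc : 0 < lam * m := mul_pos hlam hm0
  -- (1) the graded budget is at most `m^ε D`
  have hbud : ∑ χ ∈ S, d χ ^ (2 + ε) ≤ m ^ ε * D := by
    calc ∑ χ ∈ S, d χ ^ (2 + ε) ≤ ∑ χ ∈ S, d χ ^ (2 : ℝ) * m ^ ε :=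
          Finset.sum_le_sum fun χ hχ =>
            tilingUniversality_term_budget (hd χ hχ) (hmax χ hχ) hε.le
      _ = m ^ ε * D := by rw [← Finset.sum_mul, mul_comm]
  -- (2) the value is at least `(λ m)^ε η D`
  have hval : (lam * m) ^ ε * (η * D) ≤ ∑ i, V i ^ ((2 + ε) / 3) := by
    calc (lam * m) ^ ε * (η * D) ≤ (lam * m) ^ ε * ∑ i, V i ^ ((2 : ℝ) / 3) :=
          mul_le_mul_of_nonneg_left heff (Real.rpow_nonneg hc.le _)
      _ = ∑ i, V i ^ ((2 : ℝ) / 3) * (lam * m) ^ ε := by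
          rw [Finset.mul_sum]
          exact Finset.sum_congr rfl fun i _ => mul_comm _ _
      _ ≤ ∑ i, V i ^ ((2 + ε) / 3) :=
          Finset.sum_le_sum fun i _ => tilingUniversality_term_value hc (hblk i χm hχm) hε.le
  -- (3) comparison of the two bounds
  have hpos : 0 < m ^ ε * D := mul_pos (Real.rpow_pos_of_pos hm0 _) hD0
  calc ∑ χ ∈ S, d χ ^ (2 + ε) ≤ m ^ ε * D := hbud
    _ = m ^ ε * D * 1 := (mul_one _).symm
    _ < m ^ ε * D * (η * lam ^ ε) := mul_lt_mul_of_pos_left hkey hpos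
    _ = (lam * m) ^ ε * (η * D) := by
        rw [Real.mul_rpow hlam.le hm0.le]
        ring
    _ ≤ ∑ i, V i ^ ((2 + ε) / 3) := hval

/-- **stub_tilingUniversality — tiling families are graded simultaneous families at every
exponent `2 + ε`.**  A fixed block-to-dimension ratio `λ > 1` and, for every efficiency `η < 1`,
a finite host with a bi-invariant `J`, wall `D = Σ_{Irr∩J} χ(1)² > 0`, `t` simultaneously
`J`-separated blocks with `(λ χ(1))³ ≤ |X_i| |Y_i| |Z_i|` for every block and visible irreducible,
and `η D ≤ Σ_i (|X_i| |Y_i| |Z_i|)^{2/3}`, give for every `ε > 0` a member with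
`Σ_{Irr∩J} χ(1)^{2+ε} < Σ_i (|X_i| |Y_i| |Z_i|)^{(2+ε)/3}` (take `η ∈ (λ^{-ε}, 1)`; power means,
host-free). [cite: CohnKleinbergSzegedyUmans2005, Thm. 5.5] -/
theorem stub_tilingUniversality
    (h : ∃ lam : ℝ, 1 < lam ∧ ∀ η : ℝ, η < 1 → ∃ (G : Type) (_ : Group G) (_ : Fintype G)
      (J : Submodule ℂ (G → ℂ)) (t : ℕ) (X Y Z : Fin t → Finset G),
      (∀ f ∈ J, ∀ a b : G, (fun g : G => f (a * g * b)) ∈ J) ∧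
      (∀ i : Fin t, ∀ x₀ ∈ X i, ∀ z₀ ∈ Z i, ∃ f ∈ J, ∀ a b : Fin t,
        ∀ x ∈ X a, ∀ y ∈ Y a, ∀ y' ∈ Y b, ∀ z ∈ Z b,
          ((a = i ∧ b = i ∧ x = x₀ ∧ y = y' ∧ z = z₀) → f (x⁻¹ * y * y'⁻¹ * z) = 1) ∧
          (¬ (a = i ∧ b = i ∧ x = x₀ ∧ y = y' ∧ z = z₀) → f (x⁻¹ * y * y'⁻¹ * z) = 0)) ∧
      (0 < ∑ᶠ χ ∈ Literature.RepresentationTheory.FiniteGroups.irrChars G ∩ (J : Set (G → ℂ)),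
        (χ 1).re ^ (2 : ℝ)) ∧
      (∀ i : Fin t,
        ∀ χ ∈ Literature.RepresentationTheory.FiniteGroups.irrChars G ∩ (J : Set (G → ℂ)),
          (lam * (χ 1).re) ^ (3 : ℕ) ≤ (((X i).card * (Y i).card * (Z i).card : ℕ) : ℝ)) ∧
      (η * ∑ᶠ χ ∈ Literature.RepresentationTheory.FiniteGroups.irrChars G ∩ (J : Set (G → ℂ)),
        (χ 1).re ^ (2 : ℝ) ≤
          ∑ i, (((X i).card * (Y i).card * (Z i).card : ℕ) : ℝ) ^ ((2 : ℝ) / 3)))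
    (ε : ℝ) (hε : 0 < ε) :
    ∃ (G : Type) (_ : Group G) (_ : Fintype G) (J : Submodule ℂ (G → ℂ)) (t : ℕ)
      (X Y Z : Fin t → Finset G),
      (∀ f ∈ J, ∀ a b : G, (fun g : G => f (a * g * b)) ∈ J) ∧
      (∀ i : Fin t, ∀ x₀ ∈ X i, ∀ z₀ ∈ Z i, ∃ f ∈ J, ∀ a b : Fin t,
        ∀ x ∈ X a, ∀ y ∈ Y a, ∀ y' ∈ Y b, ∀ z ∈ Z b,
          ((a = i ∧ b = i ∧ x = x₀ ∧ y = y' ∧ z = z₀) → f (x⁻¹ * y * y'⁻¹ * z) = 1) ∧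
          (¬ (a = i ∧ b = i ∧ x = x₀ ∧ y = y' ∧ z = z₀) → f (x⁻¹ * y * y'⁻¹ * z) = 0)) ∧
      (∑ᶠ χ ∈ Literature.RepresentationTheory.FiniteGroups.irrChars G ∩ (J : Set (G → ℂ)),
        (χ 1).re ^ (2 + ε)) <
        ∑ i, (((X i).card * (Y i).card * (Z i).card : ℕ) : ℝ) ^ ((2 + ε) / 3) := by
  obtain ⟨lam, hlam, hfam⟩ := h
  obtain ⟨η, hη1, -, hkey⟩ := tilingUniversality_eta hlam hε
  obtain ⟨G, _instG, _instF, J, t, X, Y, Z, hJ, hsep, hD0, hblk, heff⟩ := hfam η hη1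
  refine ⟨G, inferInstance, inferInstance, J, t, X, Y, Z, hJ, hsep, ?_⟩
  have hfin : (irrChars G ∩ (J : Set (G → ℂ))).Finite :=
    (irrChars_finite_holds G).subset Set.inter_subset_left
  rw [finsum_mem_eq_finite_toFinset_sum _ hfin] at hD0 heff
  rw [finsum_mem_eq_finite_toFinset_sum _ hfin]
  exact tilingUniversality_abstract hfin.toFinset (fun χ => (χ 1).re) t
    (fun i => (((X i).card * (Y i).card * (Z i).card : ℕ) : ℝ)) lam η ε hε (one_pos.trans hlam)
    hkey (fun χ hχ => wreathBudget_one_le_re (hfin.mem_toFinset.mp hχ).1) hD0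
    (fun i χ hχ => hblk i χ (hfin.mem_toFinset.mp hχ)) heff

end Summit.MatrixMultiplication.MatrixMultiplication.Theorems.GradedDesignFamily

end
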